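import Literature.NumberTheory.Automorphic.AshSmithTheoryHecke
import HarnessLib

/-!
# Ash (2003), *Smith theory and Hecke operators* — proofs towards the named fact
# `Ash2003_inducedRayClassCharacter_attached`: the characteristic polynomial of `Ind(χ)(g)`

Topic `NumberTheory/Automorphic`; companion of `Literature.NumberTheory.Automorphic.AshSmithTheoryHecke`
(the named fact `Ash2003_inducedRayClassCharacter_attached`, A. Ash, *Smith theory and Hecke
operators*, J. Algebra **259** (2003) 43–58 [Ash2003], Thm. 1.1 / Cor. 4.4).  The Galois half of
the printed proof ([Ash2003, Lemma 4.2], from Ash, Duke Math. J. 65 (1992) Thm. 6.1.2) is the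
computation of the characteristic polynomial of a Frobenius element in the representation
`Ind_{G_L}^{G_ℚ} θ` induced from a CHARACTER.  This file proves the purely group-theoretic core of
that computation, for the tree's matrix model `GaloisRepresentations.indMatrix` of induced
representations (Serre, *Linear representations of finite groups*, §3.3, matrix form of `Ind`):

* `charpoly_indMatrix_eq_prod`: let `φ : H →* G` be injective with NORMAL image of finite index,
  `χ : H →* R` a character (any commutative ring `R`), `r` a transversal of `G / φ(H)` and `g ∈ G`
  with image `ḡ ∈ G / φ(H)` of order `f`.  If `τ : κ → G` is a system of representatives of the
  double cosets `⟨g⟩ \ G / φ(H)` (hypotheses `hcov`, `hdisj`) and `φ(s_k) = τ_k⁻¹ g^f τ_k`, then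
  `det(X - Ind(χ)(g)) = ∏_k (X^f - χ(s_k))`.
  Proof: the characteristic polynomial does not depend on the transversal
  (`charpoly_indMatrix_eq_of_transversal`: another transversal relabels the cosets and moves the
  representatives inside them, which conjugates `Ind(χ)(g)` by a monomial matrix —
  `indMatrix_mul_map_apply`, `indMatrix_comp_submatrix` of `InducedGaloisRep`); for the transversal
  `g^t τ_k` (`0 ≤ t < f`) adapted to `g`, the matrix `Ind(χ)(g)` is block diagonal with one
  `f × f` block per double coset, the weighted cyclic shift with weight `χ(s_k)` in the corner, whose
  characteristic polynomial is `X^f - χ(s_k)` (`charpoly_cyclicShift`, a Laplace expansion along the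
  first row; `charpoly_blockDiagonal`).
  This is the familiar `det(1 - Ind(χ)(Frob) T) = ∏_{w ∣ v} (1 - χ(Frob_w) T^{f_w})` once the double
  cosets `⟨Frob_v⟩ \ Γ_K / Γ_L` are matched with the places `w ∣ v` (done, for `L = ℚ(ζ_p)`, in the
  arithmetic companion file).  Unlike the tree's
  `RepresentationTheory.FiniteGroups.reverse_charpoly_restrict_invariants_eq_prod_of_equiv_ind`
  (Artin's Euler factor of an induced representation, characteristic `0`, with inertia invariants),
  the statement here is for characters, unramified, and valid in every characteristic — as needed
  for mod `p` coefficients.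

## References

* A. Ash, *Smith theory and Hecke operators*, J. Algebra 259 (2003) 43–58, Lemma 4.2 [Ash2003].
* J.-P. Serre, *Linear representations of finite groups*, GTM 42 (1977), §3.3 (Thm. 12 and its
  proof), §7.3 Prop. 22 (restriction of induced representations, Mackey)
  [SerreLinearRepresentations1977].
* J. Neukirch, *Algebraic Number Theory* (1999), VII §10, proof of (10.4) (iv), pp. 523–524 (the
  same double-coset computation for Artin `L`-functions) [NeukirchANT1999].
-/

noncomputable section

open Polynomial

namespace Literature.NumberTheory.Automorphic

namespace Ash2003

/-! ### The weighted cyclic shift and block diagonal matrices -/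

section Matrices

variable {R : Type*} [CommRing R]

/-- **Characteristic polynomial of the weighted cyclic shift.**  The `f × f` matrix `S(c)` with
`S(c)_{t'+1, t'} = 1` (`0 ≤ t' < f - 1`), `S(c)_{0, f-1} = c` and all other entries `0` (the matrix of
`e_{t'} ↦ e_{t'+1}`, `e_{f-1} ↦ c e_0`, i.e. of multiplication by `X` on `R[X]/(X^f - c)`) has
characteristic polynomial `X^f - c`.  Proof: Laplace expansion of `det(X - S(c))` along the first
row; the two minors are triangular with diagonals `X` and `-1`. [folklore] -/
theorem charpoly_cyclicShift {f : ℕ} (hf : 0 < f) (c : R) :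
    (Matrix.of fun i j : Fin f =>
        if (i : ℕ) = j + 1 then (1 : R) else if (j : ℕ) + 1 = f ∧ (i : ℕ) = 0 then c else 0).charpoly =
      X ^ f - C c := by
  obtain ⟨m, rfl⟩ : ∃ m, f = m + 1 := ⟨f - 1, by omega⟩
  cases m with
  | zero =>
    rw [Matrix.charpoly, Matrix.det_fin_one, Matrix.charmatrix_apply, Matrix.diagonal_apply_eq,
      Matrix.of_apply]
    simp
  | succ m =>
    set S : Matrix (Fin (m + 1 + 1)) (Fin (m + 1 + 1)) R := Matrix.of fun i j : Fin (m + 1 + 1) =>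
        if (i : ℕ) = j + 1 then (1 : R) else if (j : ℕ) + 1 = m + 1 + 1 ∧ (i : ℕ) = 0 then c else 0
      with hS
    have hSij : ∀ i j : Fin (m + 1 + 1), S i j =
        if (i : ℕ) = j + 1 then (1 : R) else if (j : ℕ) + 1 = m + 1 + 1 ∧ (i : ℕ) = 0 then c else 0 :=
      fun i j => rfl
    rw [Matrix.charpoly, Matrix.det_succ_row_zero,
      Fintype.sum_eq_add (0 : Fin (m + 1 + 1)) (Fin.last (m + 1)) (by simp [Fin.ext_iff]) ?_]
    · have h00 : S.charmatrix 0 0 = X := by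
        rw [Matrix.charmatrix_apply, Matrix.diagonal_apply_eq, hSij]
        simp
      have h0l : S.charmatrix 0 (Fin.last (m + 1)) = -C c := by
        rw [Matrix.charmatrix_apply, Matrix.diagonal_apply_ne _ (by simp [Fin.ext_iff]), hSij]
        simp
      -- minor at `(0,0)`: lower triangular with diagonal `X`
      have hmin0 : (S.charmatrix.submatrix Fin.succ (Fin.succAbove 0)).det = X ^ (m + 1) := by
        rw [Fin.succAbove_zero, Matrix.det_of_lowerTriangular]
        · have hdiag : ∀ i : Fin (m + 1),
              (S.charmatrix.submatrix Fin.succ Fin.succ) i i = X := fun i => by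
            rw [Matrix.submatrix_apply, Matrix.charmatrix_apply, Matrix.diagonal_apply_eq, hSij]
            simp [Fin.val_succ]
          rw [Finset.prod_congr rfl fun i _ => hdiag i, Finset.prod_const, Finset.card_univ,
            Fintype.card_fin]
        · intro i j hij
          have hij' : i < j := hij
          rw [Matrix.submatrix_apply, Matrix.charmatrix_apply,
            Matrix.diagonal_apply_ne _ (by intro h; exact hij'.ne (Fin.succ_injective _ h)), hSij]
          have h1 : ¬ ((Fin.succ i : ℕ) = (Fin.succ j : ℕ) + 1) := by
            simp only [Fin.val_succ]; have := hij'; omega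
          have h2 : ¬ (((Fin.succ j : ℕ) + 1 = m + 1 + 1) ∧ ((Fin.succ i : ℕ) = 0)) := by
            simp [Fin.val_succ]
          rw [if_neg h1, if_neg h2, map_zero, sub_zero]
      -- minor at `(0, f-1)`: upper triangular with diagonal `-1`
      have hminl : (S.charmatrix.submatrix Fin.succ (Fin.succAbove (Fin.last (m + 1)))).det =
          (-1) ^ (m + 1) := by
        rw [Fin.succAbove_last, Matrix.det_of_upperTriangular]
        · have hdiag : ∀ i : Fin (m + 1),
              (S.charmatrix.submatrix Fin.succ Fin.castSucc) i i = -1 := fun i => by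
            rw [Matrix.submatrix_apply, Matrix.charmatrix_apply,
              Matrix.diagonal_apply_ne _ (by simp [Fin.ext_iff]), hSij]
            simp [Fin.val_succ]
          rw [Finset.prod_congr rfl fun i _ => hdiag i, Finset.prod_const, Finset.card_univ,
            Fintype.card_fin]
        · intro i j hij
          have hij' : j < i := hij
          rw [Matrix.submatrix_apply, Matrix.charmatrix_apply,
            Matrix.diagonal_apply_ne _ (by
              intro h; have := congrArg Fin.val h; simp at this; have := hij'; omega), hSij]
          have h1 : ¬ ((Fin.succ i : ℕ) = (Fin.castSucc j : ℕ) + 1) := by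
            simp only [Fin.val_succ, Fin.val_castSucc]; have := hij'; omega
          have h2 : ¬ (((Fin.castSucc j : ℕ) + 1 = m + 1 + 1) ∧ ((Fin.succ i : ℕ) = 0)) := by
            simp [Fin.val_succ]
          rw [if_neg h1, if_neg h2, map_zero, sub_zero]
      have hsq : ((-1 : R[X]) ^ (m + 1)) * (-1) ^ (m + 1) = 1 := by
        rw [← pow_add, ← two_mul, pow_mul, neg_one_sq, one_pow]
      rw [h00, h0l, hmin0, hminl]
      simp only [Fin.val_zero, pow_zero, one_mul, Fin.val_last]
      linear_combination (-C c) * hsq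
    · -- all other terms of the Laplace expansion vanish
      rintro j ⟨hj0, hjl⟩
      have hj : S.charmatrix 0 j = 0 := by
        rw [Matrix.charmatrix_apply, Matrix.diagonal_apply_ne _ (Ne.symm hj0), hSij]
        have h1 : ¬ (((0 : Fin (m + 2)) : ℕ) = (j : ℕ) + 1) := by simp
        have h2 : ¬ (((j : ℕ) + 1 = m + 1 + 1) ∧ (((0 : Fin (m + 2)) : ℕ) = 0)) := by
          rintro ⟨h, -⟩
          apply hjl
          ext
          rw [Fin.val_last]
          omega
        rw [if_neg h1, if_neg h2, map_zero, sub_zero]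
      rw [hj, mul_zero, zero_mul]

/-- **The characteristic polynomial of a block diagonal matrix is the product of those of its
blocks** (`charmatrix` of a block diagonal matrix is block diagonal; Mathlib
`Matrix.det_blockDiagonal`). [folklore] -/
theorem charpoly_blockDiagonal {o n : Type*} [Fintype o] [DecidableEq o] [Fintype n]
    [DecidableEq n] (M : o → Matrix n n R) :
    (Matrix.blockDiagonal M).charpoly = ∏ k, (M k).charpoly := by
  have h : (Matrix.blockDiagonal M).charmatrix = Matrix.blockDiagonal fun k => (M k).charmatrix := by
    ext ⟨i, k⟩ ⟨j, k'⟩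
    simp only [Matrix.charmatrix_apply, Matrix.blockDiagonal_apply, Matrix.diagonal_apply,
      Prod.mk.injEq]
    by_cases hk : k = k'
    · subst hk
      simp
    · simp [hk]
  rw [Matrix.charpoly, h, Matrix.det_blockDiagonal]
  rfl

end Matrices

/-! ### Characteristic polynomials of `Ind(χ)(g)` -/

section Induced

variable {H G : Type*} [Group H] [Group G] {R : Type*}

/-- For a transversal `r` of `G / φ(H)`, the extension by zero `χ̇` of `χ` satisfies
`χ̇(r_a⁻¹ r_b) = δ_{ab}` (distinct representatives lie in distinct cosets).
Ref: Serre, *Linear representations of finite groups*, §3.3, proof of Thm. 12. [folklore] -/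
theorem dotExtend_inv_mul_eq_ite [MulZeroOneClass R] {ι : Type*} [DecidableEq ι] {φ : H →* G}
    (hφ : Function.Injective φ) (χ : H →* R) {r : ι → G}
    (hr : Function.Injective fun i => (r i : G ⧸ φ.range)) (a b : ι) :
    GaloisRepresentations.dotExtend φ χ ((r a)⁻¹ * r b) = if a = b then 1 else 0 := by
  split_ifs with hab
  · subst hab
    rw [inv_mul_cancel, GaloisRepresentations.dotExtend_one hφ]
  · refine GaloisRepresentations.dotExtend_of_not_mem φ χ fun hmem => hab (hr ?_)
    change (r a : G ⧸ φ.range) = (r b : G ⧸ φ.range)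
    rwa [QuotientGroup.eq]

variable [CommRing R]

/-- **The characteristic polynomial of `Ind(χ)(g)` does not depend on the transversal** (for a
character `χ`): two transversals `r : ι → G`, `r' : ι' → G` of `G / φ(H)` differ by a relabelling
`s : ι' ≃ ι` of the cosets and by moving the representatives inside their cosets,
`r'_k = r_{s k} φ(h_k)`, so `Ind'(χ)(g) = D⁻¹ · Ind(χ)(g)^s · D` with `D = diag(χ(h_k))`
(`indMatrix_mul_map_apply`, `indMatrix_comp_submatrix`), and the characteristic polynomial is
invariant under conjugation and relabelling (Mathlib `Matrix.charpoly_mul_comm`,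
`Matrix.charpoly_reindex`).
Ref: Serre, *Linear representations of finite groups*, §3.3 Thm. 11 (uniqueness of `Ind`). [folklore] -/
theorem charpoly_indMatrix_eq_of_transversal {φ : H →* G} (hφ : Function.Injective φ) (χ : H →* R)
    {ι ι' : Type*} [Fintype ι] [DecidableEq ι] [Fintype ι'] [DecidableEq ι']
    {r : ι → G} {r' : ι' → G}
    (hr : Function.Bijective fun i => (r i : G ⧸ φ.range))
    (hr' : Function.Bijective fun i => (r' i : G ⧸ φ.range)) (g : G) :
    (GaloisRepresentations.indMatrix φ χ r' g).charpoly =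
      (GaloisRepresentations.indMatrix φ χ r g).charpoly := by
  set er := Equiv.ofBijective _ hr with her
  set er' := Equiv.ofBijective _ hr' with her'
  set s : ι' ≃ ι := er'.trans er.symm with hsdef
  have hsk : ∀ k, (r (s k) : G ⧸ φ.range) = (r' k : G ⧸ φ.range) := fun k =>
    er.apply_symm_apply (er' k)
  have hmem : ∀ k, ∃ a, φ a = (r (s k))⁻¹ * r' k := fun k => QuotientGroup.eq.mp (hsk k)
  choose h hh using hmem
  have hr'eq : r' = fun k => r (s k) * φ (h k) := funext fun k => by rw [hh, mul_inv_cancel_left]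
  have hN' : GaloisRepresentations.indMatrix φ χ r' g =
      Matrix.diagonal (fun k => χ (h k)⁻¹) *
        (GaloisRepresentations.indMatrix φ χ r g).submatrix s s *
          Matrix.diagonal (fun k => χ (h k)) := by
    ext k k'
    rw [Matrix.mul_diagonal, Matrix.diagonal_mul, Matrix.submatrix_apply, hr'eq,
      GaloisRepresentations.indMatrix_mul_map_apply hφ χ (fun k => r (s k)) h g k k']
    rfl
  rw [hN', Matrix.charpoly_mul_comm, ← Matrix.mul_assoc, Matrix.diagonal_mul_diagonal]
  have h1 : (Matrix.diagonal fun k => χ (h k) * χ (h k)⁻¹) = (1 : Matrix ι' ι' R) := by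
    rw [← Matrix.diagonal_one]
    congr 1
    funext k
    rw [← map_mul, mul_inv_cancel, map_one]
  rw [h1, Matrix.one_mul]
  exact Matrix.charpoly_reindex s.symm (GaloisRepresentations.indMatrix φ χ r g)

/-- **The characteristic polynomial of `Ind(χ)(g)` for a character `χ`.**  Let `φ : H →* G` be
injective with normal image, `χ : H →* R` a character, `r : ι → G` a (finite) transversal of
`G / φ(H)` and `g ∈ G`; let `f` be the order of `ḡ = g φ(H)` in `G / φ(H)`.  Let `τ : κ → G`
represent the double cosets `⟨g⟩ \ G / φ(H)`: every `x ∈ G` is `g^t τ_k φ(a)` (`hcov`) and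
`τ_{k'} ∈ g^t τ_k φ(H)` forces `k = k'` (`hdisj`); and let `s_k ∈ H` with `φ(s_k) = τ_k⁻¹ g^f τ_k`
(`g^f ∈ φ(H)`, which is normal).  Then
`det(X - Ind(χ)(g)) = ∏_k (X^f - χ(s_k))`.
Proof: pass to the transversal `g^t τ_k`, `0 ≤ t < f` (`charpoly_indMatrix_eq_of_transversal`), for
which `Ind(χ)(g)` is block diagonal with blocks the weighted cyclic shifts `S(χ(s_k))`
(`charpoly_blockDiagonal`, `charpoly_cyclicShift`).  With `G = Γ_K`, `H = Γ_L`, `g = Frob_𝔓` this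
is `det(X - Ind(χ)(Frob_v)) = ∏_{w ∣ v} (X^{f} - χ(Frob_w))`.
Ref: Serre, *Linear representations of finite groups*, §3.3 and §7.3 Prop. 22; Neukirch,
*Algebraic Number Theory*, VII §10, proof of (10.4) (iv). [folklore] -/
theorem charpoly_indMatrix_eq_prod {φ : H →* G} (hφ : Function.Injective φ) [hN : φ.range.Normal]
    (χ : H →* R) {ι : Type*} [Fintype ι] [DecidableEq ι] {r : ι → G}
    (hr : Function.Bijective fun i => (r i : G ⧸ φ.range)) (g : G)
    {κ : Type*} [Fintype κ] [DecidableEq κ] (τ : κ → G) (s : κ → H)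
    (hcov : ∀ x : G, ∃ k, ∃ t : ℕ, ∃ a : H, x = g ^ t * τ k * φ a)
    (hdisj : ∀ (k k' : κ) (t : ℕ) (a : H), τ k' = g ^ t * τ k * φ a → k = k')
    (hs : ∀ k, φ (s k) = (τ k)⁻¹ * g ^ orderOf (g : G ⧸ φ.range) * τ k) :
    (GaloisRepresentations.indMatrix φ χ r g).charpoly =
      ∏ k, (X ^ orderOf (g : G ⧸ φ.range) - C (χ (s k))) := by
  set f := orderOf (g : G ⧸ φ.range) with hfdef
  haveI : Finite (G ⧸ φ.range) := Finite.of_equiv ι (Equiv.ofBijective _ hr)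
  have hf : 0 < f := orderOf_pos _
  -- `g ^ t ∈ φ(H)` iff `f ∣ t`
  have hpow : ∀ t : ℕ, g ^ t ∈ φ.range ↔ f ∣ t := fun t => by
    rw [← QuotientGroup.eq_one_iff, QuotientGroup.mk_pow]
    exact ⟨fun h => orderOf_dvd_of_pow_eq_one h, fun h => orderOf_dvd_iff_pow_eq_one.mp h⟩
  have hconj : ∀ x y : G, x ∈ φ.range → y⁻¹ * x * y ∈ φ.range := fun x y hx => by
    simpa using hN.conj_mem x hx y⁻¹
  have hconj' : ∀ x y : G, y⁻¹ * x * y ∈ φ.range → x ∈ φ.range := fun x y hx => by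
    have := hN.conj_mem _ hx y
    simpa [mul_assoc] using this
  -- the transversal adapted to `g`
  set r' : Fin f × κ → G := fun tk => g ^ (tk.1 : ℕ) * τ tk.2 with hr'def
  have hr'a : ∀ (t : Fin f) (k : κ), r' (t, k) = g ^ (t : ℕ) * τ k := fun _ _ => rfl
  have key : ∀ (t t' : Fin f) (k k' : κ), (t : ℕ) ≤ t' →
      ((r' (t, k) : G ⧸ φ.range) = r' (t', k')) → (t, k) = (t', k') := by
    intro t t' k k' htt' heq
    rw [QuotientGroup.eq, hr'a, hr'a] at heq
    have h2 : g ^ (t' : ℕ) = g ^ (t : ℕ) * g ^ ((t' : ℕ) - t) := by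
      rw [← pow_add, Nat.add_sub_cancel' htt']
    have h1 : (g ^ (t : ℕ) * τ k)⁻¹ * (g ^ (t' : ℕ) * τ k') =
        (τ k)⁻¹ * g ^ ((t' : ℕ) - t) * τ k' := by
      rw [h2]; group
    rw [h1] at heq
    obtain ⟨a, ha⟩ := heq
    have hkk : k' = k := by
      refine hdisj k' k ((t' : ℕ) - t) a⁻¹ ?_
      rw [map_inv, ha]; group
    subst hkk
    have hmem : g ^ ((t' : ℕ) - t) ∈ φ.range := hconj' _ (τ k') ⟨a, ha⟩
    have h0 : (t' : ℕ) - t = 0 :=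
      Nat.eq_zero_of_dvd_of_lt ((hpow _).mp hmem) (by have := t'.2; omega)
    have : t = t' := Fin.ext (by omega)
    rw [this]
  have hr'inj : Function.Injective fun tk : Fin f × κ => (r' tk : G ⧸ φ.range) := by
    rintro ⟨t, k⟩ ⟨t', k'⟩ heq
    rcases le_total (t : ℕ) t' with h | h
    · exact key _ _ _ _ h heq
    · exact (key _ _ _ _ h heq.symm).symm
  have hr'surj : Function.Surjective fun tk : Fin f × κ => (r' tk : G ⧸ φ.range) := by
    intro q
    induction q using QuotientGroup.induction_on with
    | H x =>
      obtain ⟨k, t, a, rfl⟩ := hcov x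
      refine ⟨(⟨t % f, Nat.mod_lt _ hf⟩, k), ?_⟩
      change (r' _ : G ⧸ φ.range) = _
      rw [QuotientGroup.eq, hr'a]
      have hgt : g ^ t = g ^ (t % f) * g ^ (f * (t / f)) := by
        rw [← pow_add, Nat.mod_add_div]
      have hx : (g ^ (t % f) * τ k)⁻¹ * (g ^ t * τ k * φ a) =
          ((τ k)⁻¹ * g ^ (f * (t / f)) * τ k) * φ a := by
        rw [hgt]
        group
      rw [hx]
      exact φ.range.mul_mem (hconj _ _ ((hpow _).mpr (dvd_mul_right f _))) ⟨a, rfl⟩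
  have hr' : Function.Bijective fun tk : Fin f × κ => (r' tk : G ⧸ φ.range) := ⟨hr'inj, hr'surj⟩
  rw [← charpoly_indMatrix_eq_of_transversal hφ χ hr hr' g]
  -- block form of `Ind(χ)(g)` in the adapted transversal
  have hblock : GaloisRepresentations.indMatrix φ χ r' g = Matrix.blockDiagonal fun k =>
      Matrix.of fun i j : Fin f =>
        if (i : ℕ) = j + 1 then (1 : R) else if (j : ℕ) + 1 = f ∧ (i : ℕ) = 0 then χ (s k) else 0 := by
    ext ⟨t, k⟩ ⟨t', k'⟩
    rw [GaloisRepresentations.indMatrix_apply, Matrix.blockDiagonal_apply, Matrix.of_apply]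
    dsimp only
    by_cases hlt : (t' : ℕ) + 1 < f
    · -- `g · r'(t', k') = r'(t' + 1, k')`
      have h1 : (r' (t, k))⁻¹ * g * r' (t', k') = (r' (t, k))⁻¹ * r' (⟨(t' : ℕ) + 1, hlt⟩, k') := by
        simp only [hr'a, pow_succ]
        group
      rw [h1, dotExtend_inv_mul_eq_ite hφ χ hr'.1]
      by_cases hk : k = k'
      · subst hk
        have hne : ¬ ((t' : ℕ) + 1 = f ∧ (t : ℕ) = 0) := fun h => absurd h.1 hlt.ne
        rw [if_neg hne, if_pos rfl]
        by_cases ht : (t : ℕ) = t' + 1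
        · rw [if_pos ht, if_pos (show (t, k) = (⟨(t' : ℕ) + 1, hlt⟩, k) from
            Prod.ext (Fin.ext ht) rfl)]
        · rw [if_neg ht, if_neg (show ¬ (t, k) = (⟨(t' : ℕ) + 1, hlt⟩, k) from
            fun h => ht (congrArg Fin.val (Prod.mk.inj h).1))]
      · rw [if_neg (show ¬ (t, k) = (⟨(t' : ℕ) + 1, hlt⟩, k') from fun h => hk (Prod.mk.inj h).2),
          if_neg hk]
    · have heq : (t' : ℕ) + 1 = f := le_antisymm t'.2 (not_lt.mp hlt)
      -- `g · r'(t', k') = r'(0, k') · φ(s k')`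
      have h1 : (r' (t, k))⁻¹ * g * r' (t', k') =
          (r' (t, k))⁻¹ * r' (⟨0, hf⟩, k') * φ (s k') := by
        have hgf : g ^ f = g ^ (t' : ℕ) * g := by rw [← pow_succ, heq]
        rw [hs k', hgf]
        simp only [hr'a, pow_zero, one_mul]
        group
      rw [h1, GaloisRepresentations.dotExtend_mul_map hφ, dotExtend_inv_mul_eq_ite hφ χ hr'.1]
      by_cases hk : k = k'
      · subst hk
        have ht : ¬ ((t : ℕ) = t' + 1) := by have := t.2; omega
        rw [if_neg ht, if_pos rfl]
        by_cases ht0 : (t : ℕ) = 0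
        · rw [if_pos (show (t, k) = (⟨0, hf⟩, k) from Prod.ext (Fin.ext ht0) rfl), one_mul,
            if_pos ⟨heq, ht0⟩]
        · rw [if_neg (show ¬ (t, k) = (⟨0, hf⟩, k) from
              fun h => ht0 (congrArg Fin.val (Prod.mk.inj h).1)), zero_mul,
            if_neg (fun h => ht0 h.2)]
      · rw [if_neg (show ¬ (t, k) = (⟨0, hf⟩, k') from fun h => hk (Prod.mk.inj h).2), zero_mul,
          if_neg hk]
  rw [hblock, charpoly_blockDiagonal]
  exact Finset.prod_congr rfl fun k _ => charpoly_cyclicShift hf _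

end Induced

end Ash2003

end Literature.NumberTheory.Automorphic
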